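import Summits.MatrixMultiplication.OmegaCensus.STPPSmallPatternKernelInvariant122
import Summits.MatrixMultiplication.OmegaCensus.STPPSmallPatternCriteria
import Mathlib.Data.Fin.Tuple.Sort

/-!
# ω-census, small STPP pattern `(1,2,2)^k`: kernel search — reflection through Def. 5.1

HONEST FRAMING (pub-omega census; verbatim): lottery ticket; floor = certified bounds/negative ranges.
Census STRUCTURE bookkeeping of the STPP track (seat pub-omega-stpp-3, gen 23; STRUCTURE row B5, the threshold column
`T2(H) = max {k : (1,2,2)^k ⊆ H}` — its LOWER sides as kernel theorems), not progress on `ω`: small patterns in small groups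
bound no exponent.

Second reflection file for `STPPSmallPatternKernelSearch122.lean`; the theorem the per-group files use is
`not_exists_isSTPP_122_of_search2`:

> if `search2 E.g K reps = true` (a `decide +kernel` evaluation) and every nonzero `d` is carried into the code list `reps` by an
> injective additive map from `auts` (kernel decisions), then `G` admits NO STPP family (CKSU Def. 5.1, tree `IsSTPP`) of `K`
> triples with `|Aᵢ| = 1`, `|Bᵢ| = |Cᵢ| = 2`.

Proof: along the branch of a normal-form solution every loop of `level2` reaches the solution's codes (invariant ⇒ clear
forbidden bits), the literal tests pass, the child state satisfies the invariant again (`level2_false`, `below2_false`,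
`start2_false`); every solution has a normal form (orientation, translations `b₀ = c₀ = 0`, covering automorphism, sorting by
the code of `bᵢ` via `Tuple.sort`); the criterion `exists_isSTPP_122_iff` (`STPPSmallPatternCriteria.lean`) concludes.

References: H. Cohn, R. Kleinberg, B. Szegedy, C. Umans, FOCS 2005 (arXiv:math/0511460), Def. 5.1.  Record: pub-omega HOME
`pub-omega-stpp-3-g23/` (mirror `k122.py` = lister122 normal-form counts; kernel timing `(1,2,2)³ ⊄ ℤ/23` ≈ 80 s).
-/

namespace Summit.MatrixMultiplication.OmegaCensus

namespace STPP122Neg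

open STPP211Neg Literature.Computability.AlgebraicComplexity

section Refl

variable {G : Type} [AddCommGroup G] {E : GEnc G} {K : ℕ} {b b' c c' : Fin K → G}

/-! ### One level of the search along the solution -/

/-- The free-`b` mask of `level2`. -/
def fB (g : GC) (S : St2) : ℕ := Nat.xor g.full (Nat.lor (Nat.lor S.BS S.PB) (Nat.land (lowMask (Nat.add S.lastB 1)) g.full))

/-- The free-`b'` mask of `level2` (free `b`-codes above `b`). -/
def fB2 (g : GC) (S : St2) (b : ℕ) : ℕ :=
  Nat.xor g.full (Nat.lor (Nat.xor g.full (fB g S)) (Nat.land (lowMask (Nat.add b 1)) g.full))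

/-- The free-`c` mask of `level2`. -/
def fC (g : GC) (S : St2) (b b' : ℕ) : ℕ :=
  Nat.xor g.full (Nat.lor (Nat.lor (Nat.lor S.CS S.PC) (g.tr S.NIM b)) (g.tr S.NIM b'))

/-- The free-`c'` mask of `level2` (free `c`-codes above `c`). -/
def fC2 (g : GC) (S : St2) (b b' c : ℕ) : ℕ :=
  Nat.xor g.full (Nat.lor (Nat.xor g.full (fC g S b b')) (Nat.land (lowMask (Nat.add c 1)) g.full))

/-- `level2` unfolded. -/
theorem level2_eq (g : GC) (S : St2) (k : St2 → Bool) :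
    level2 g S k = allBits (fB g S) (fun b => allBits (fB2 g S b) (fun b' => allBits (fC g S b b') (fun c =>
      allBits (fC2 g S b b' c) (fun c' => !(validNew g S b b' c c') || child2 g S b b' c c' k) (fC2 g S b b' c))
      (fC g S b b')) (fB2 g S b)) (fB g S) := by
  unfold level2 fB fB2 fC fC2; simp only [force_eq]; rfl

/-- A code bit of `full ^^^ M` is the negation of that of `M`. -/
theorem testBit_fullXor (M : ℕ) (x : G) : (Nat.xor E.g.full M).testBit (E.enc x) = !M.testBit (E.enc x) := by
  rw [xor_eq, Nat.testBit_xor, testBit_full]; cases M.testBit (E.enc x) <;> rfl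

/-- ONE LEVEL OF THE SOLUTION'S BRANCH IS NOT REFUTED (`m ≥ 1` triples placed, the `m`-th next). -/
theorem level2_false (hM : ModelD2 b b' c c') (hNF : NF2 E b b' c c') {m : ℕ} (im : Fin K) (him : im.val = m)
    (ip : Fin K) (hip : ip.val + 1 = m) {S : St2} (hS : InvM2 E b b' c c' m S) (hlast : S.lastB = E.enc (b ip))
    {k : St2 → Bool} (hk : ∀ S', InvM2 E b b' c c' (m + 1) S' → S'.lastB = E.enc (b im) → k S' = false) :
    level2 E.g S k = false := by
  rw [level2_eq]
  have hBfree : ∀ {t : G}, InA b b' im t → (fB E.g S).testBit (E.enc t) = true := by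
    intro t ht
    unfold fB
    rw [testBit_fullXor, lor_eq, lor_eq, Nat.testBit_lor, Nat.testBit_lor, hS.bs_free hM im him ht, hS.pb_free hM im him ht,
      testBit_lowMask_land, add_eq', hlast]
    have h1 := hNF.1 ip im (by rw [Fin.lt_def]; omega)
    have h2 : E.enc (b im) ≤ E.enc t := by
      rcases ht with rfl | rfl
      · exact le_rfl
      · exact le_of_lt (hNF.2.1 im)
    simp; omega
  have hb : (fB E.g S).testBit (E.enc (b im)) = true := hBfree (inA_p im)
  have hb' : (fB2 E.g S (E.enc (b im))).testBit (E.enc (b' im)) = true := by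
    unfold fB2
    rw [testBit_fullXor, lor_eq, Nat.testBit_lor, testBit_fullXor, hBfree (inA_q im), testBit_lowMask_land, add_eq']
    have := hNF.2.1 im
    simp; omega
  have hCfree : ∀ {u : G}, InA c c' im u → (fC E.g S (E.enc (b im)) (E.enc (b' im))).testBit (E.enc u) = true := by
    intro u hu
    unfold fC
    rw [testBit_fullXor, lor_eq, lor_eq, lor_eq, Nat.testBit_lor, Nat.testBit_lor, Nat.testBit_lor,
      hS.cs_free hM im him hu, hS.pc_free hM im him hu, hS.nim_free hM im him (inA_p im) hu,
      hS.nim_free hM im him (inA_q im) hu]; rfl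
  have hc : (fC E.g S (E.enc (b im)) (E.enc (b' im))).testBit (E.enc (c im)) = true := hCfree (inA_p im)
  have hc' : (fC2 E.g S (E.enc (b im)) (E.enc (b' im)) (E.enc (c im))).testBit (E.enc (c' im)) = true := by
    unfold fC2
    rw [testBit_fullXor, lor_eq, Nat.testBit_lor, testBit_fullXor, hCfree (inA_q im), testBit_lowMask_land, add_eq']
    have := hNF.2.2 im
    simp; omega
  cases h : allBits (fB E.g S) _ (fB E.g S)
  · rfl
  exfalso
  have h1 := allBits_spec _ _ _ le_rfl h _ hb
  have h2 := allBits_spec _ _ _ le_rfl h1 _ hb'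
  have h3 := allBits_spec _ _ _ le_rfl h2 _ hc
  have h4 := allBits_spec _ _ _ le_rfl h3 _ hc'
  rw [validNew_true hM hS im him, child2_eq, hk _ (invM2_childSt2 im him hS) rfl] at h4
  exact Bool.false_ne_true h4

/-- THE SEARCH BELOW A STATE OF THE SOLUTION'S BRANCH ANSWERS `false`. -/
theorem below2_false (hM : ModelD2 b b' c c') (hNF : NF2 E b b' c c') :
    ∀ (r m : ℕ) (ip : Fin K) (S : St2), m + r = K → ip.val + 1 = m → InvM2 E b b' c c' m S → S.lastB = E.enc (b ip) →
      below2 E.g r S = false := by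
  intro r
  induction r with
  | zero => intro m ip S _ _ _ _; rfl
  | succ r ih =>
      intro m ip S hmr hip hS hlast
      have hmK : m < K := by omega
      show level2 E.g S (below2 E.g r) = false
      exact level2_false hM hNF ⟨m, hmK⟩ rfl ip hip hS hlast
        fun S' hS' hl' => ih (m + 1) ⟨m, hmK⟩ S' (by omega) rfl hS' hl'

/-- THE START OF THE SOLUTION'S REPRESENTATIVE ANSWERS `false` (`b₀ = 0`, `c₀ = 0`, `y = b'₀`). -/
theorem start2_false (hM : ModelD2 b b' c c') (hNF : NF2 E b b' c c') (hK : 0 < K) (hb0 : b ⟨0, hK⟩ = 0)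
    (hc0 : c ⟨0, hK⟩ = 0) : start2 E.g (E.enc (b' ⟨0, hK⟩)) (below2 E.g (K - 1)) = false := by
  set i0 : Fin K := ⟨0, hK⟩
  unfold start2
  rw [force_eq]
  have e0 : (0 : ℕ) = E.enc (b i0) := by rw [hb0, E.enc_zero]
  have e0' : (0 : ℕ) = E.enc (c i0) := by rw [hc0, E.enc_zero]
  have hc' : (Nat.xor E.g.full (Nat.land (lowMask 1) E.g.full)).testBit (E.enc (c' i0)) = true := by
    rw [testBit_fullXor, testBit_lowMask_land]
    have := hNF.2.2 i0; rw [← e0'] at this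
    simp; omega
  cases h : allBits (Nat.xor E.g.full (Nat.land (lowMask 1) E.g.full)) _ (Nat.xor E.g.full (Nat.land (lowMask 1) E.g.full))
  · rfl
  exfalso
  have h1 := allBits_spec _ _ _ le_rfl h _ hc'
  rw [e0] at h1
  conv at h1 => rw [show validNew E.g St2.empty (E.enc (b i0)) (E.enc (b' i0)) (E.enc (b i0)) (E.enc (c' i0)) =
    validNew E.g St2.empty (E.enc (b i0)) (E.enc (b' i0)) (E.enc (c i0)) (E.enc (c' i0)) by rw [← e0, ← e0'],
    show child2 E.g St2.empty (E.enc (b i0)) (E.enc (b' i0)) (E.enc (b i0)) (E.enc (c' i0)) (below2 E.g (K - 1)) =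
    child2 E.g St2.empty (E.enc (b i0)) (E.enc (b' i0)) (E.enc (c i0)) (E.enc (c' i0)) (below2 E.g (K - 1)) by rw [← e0, ← e0']]
  rw [validNew_true hM (invM2_empty E b b' c c') i0 rfl, child2_eq] at h1
  have hS1 := invM2_childSt2 (E := E) (b := b) (b' := b') (c := c) (c' := c') i0 rfl (invM2_empty E b b' c c')
  have hbelow : below2 E.g (K - 1) (childSt2 E.g St2.empty (E.enc (b i0)) (E.enc (b' i0)) (E.enc (c i0)) (E.enc (c' i0))) =
      false := by
    rcases Nat.eq_zero_or_pos (K - 1) with hK1 | hK1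
    · rw [hK1]; rfl
    · obtain ⟨r, hr⟩ : ∃ r, K - 1 = r + 1 := ⟨K - 1 - 1, by omega⟩
      rw [hr]
      exact below2_false hM hNF (r + 1) 1 i0 _ (by omega) rfl hS1 rfl
  rw [hbelow] at h1
  exact Bool.false_ne_true h1

/-- A `true` search refutes every listed representative. -/
theorem start2_of_search2 {g : GC} {k : ℕ} : ∀ {R : List ℕ}, search2 g k R = true → ∀ y ∈ R,
    start2 g y (below2 g (k - 1)) = true := by
  intro R
  induction R with
  | nil => intro _ y hy; simp at hy
  | cons y' R ih =>
      intro h y hy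
      rw [search2_cons, Bool.and_eq_true] at h
      rcases List.mem_cons.1 hy with rfl | hy
      · exact h.1
      · exact ih h.2 y hy

/-! ### Normal form and the reflection theorems -/

/-- Translating the `B`'s and the `C`'s and applying an injective additive map preserves the model. -/
theorem ModelD2.map_sub (hM : ModelD2 b b' c c') {G' : Type} [AddCommGroup G'] (f : G →+ G') (hf : Function.Injective f)
    (v w : G) : ModelD2 (fun i => f (b i - v)) (fun i => f (b' i - v)) (fun i => f (c i - w)) (fun i => f (c' i - w)) := by
  have pullB : ∀ i x, InA (fun i => f (b i - v)) (fun i => f (b' i - v)) i x → ∃ y, InA b b' i y ∧ x = f (y - v) := by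
    rintro i x (rfl | rfl)
    · exact ⟨b i, inA_p i, rfl⟩
    · exact ⟨b' i, inA_q i, rfl⟩
  have pullC : ∀ i x, InA (fun i => f (c i - w)) (fun i => f (c' i - w)) i x → ∃ y, InA c c' i y ∧ x = f (y - w) := by
    rintro i x (rfl | rfl)
    · exact ⟨c i, inA_p i, rfl⟩
    · exact ⟨c' i, inA_q i, rfl⟩
  have key : ∀ t t' u u' : G, f (t' - v) - f (u - w) = f (t - v) - f (u' - w) ↔ t' - u = t - u' := by
    intro t t' u u'
    rw [← AddMonoidHom.map_sub, ← AddMonoidHom.map_sub, hf.eq_iff]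
    constructor
    · intro h
      have h2 : t' - v - (u - w) + (v - w) = t - v - (u' - w) + (v - w) := by rw [h]
      rwa [show t' - v - (u - w) + (v - w) = t' - u by abel, show t - v - (u' - w) + (v - w) = t - u' by abel] at h2
    · intro h; rw [show t' - v - (u - w) = (t' - u) - (v - w) by abel, h]; abel
  refine ⟨fun i h => hM.1 i (sub_left_injective (hf h)), fun i h => hM.2.1 i (sub_left_injective (hf h)),
    fun j t t' u u' ht ht' hu hu' h => ?_, fun i j l t t' u u' hijl ht ht' hu hu' h => ?_⟩
  · obtain ⟨t₀, ht₀, rfl⟩ := pullB j t ht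
    obtain ⟨t₁, ht₁, rfl⟩ := pullB j t' ht'
    obtain ⟨u₀, hu₀, rfl⟩ := pullC j u hu
    obtain ⟨u₁, hu₁, rfl⟩ := pullC j u' hu'
    obtain ⟨e1, e2⟩ := hM.2.2.1 j t₀ t₁ u₀ u₁ ht₀ ht₁ hu₀ hu₁ ((key _ _ _ _).1 h)
    exact ⟨by rw [e1], by rw [e2]⟩
  · obtain ⟨t₀, ht₀, rfl⟩ := pullB i t ht
    obtain ⟨t₁, ht₁, rfl⟩ := pullB j t' ht'
    obtain ⟨u₀, hu₀, rfl⟩ := pullC j u hu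
    obtain ⟨u₁, hu₁, rfl⟩ := pullC l u' hu'
    exact hM.2.2.2 i j l t₀ t₁ u₀ u₁ hijl ht₀ ht₁ hu₀ hu₁ ((key _ _ _ _).1 h)

/-- Re-indexing along an injective map preserves the model. -/
theorem ModelD2.reindex (hM : ModelD2 b b' c c') {K' : ℕ} (σ : Fin K' → Fin K) (hσ : Function.Injective σ) :
    ModelD2 (b ∘ σ) (b' ∘ σ) (c ∘ σ) (c' ∘ σ) :=
  ⟨fun i => hM.1 (σ i), fun i => hM.2.1 (σ i), fun j t t' u u' => hM.2.2.1 (σ j) t t' u u',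
    fun i j l t t' u u' h => hM.2.2.2 (σ i) (σ j) (σ l) t t' u u'
      (h.imp (fun h e => h (hσ e)) (fun h e => h (hσ e)))⟩

/-- Orienting the pairs by code preserves the model. -/
theorem ModelD2.orient (hM : ModelD2 b b' c c') (E : GEnc G) :
    ModelD2 (fun i => if E.enc (b i) < E.enc (b' i) then b i else b' i) (fun i => if E.enc (b i) < E.enc (b' i) then b' i else b i)
      (fun i => if E.enc (c i) < E.enc (c' i) then c i else c' i) (fun i => if E.enc (c i) < E.enc (c' i) then c' i else c i) := by
  have sameB : ∀ i x, InA (fun i => if E.enc (b i) < E.enc (b' i) then b i else b' i)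
      (fun i => if E.enc (b i) < E.enc (b' i) then b' i else b i) i x ↔ InA b b' i x := by
    intro i x; unfold InA; dsimp only; split_ifs
    · exact Iff.rfl
    · exact Or.comm
  have sameC : ∀ i x, InA (fun i => if E.enc (c i) < E.enc (c' i) then c i else c' i)
      (fun i => if E.enc (c i) < E.enc (c' i) then c' i else c i) i x ↔ InA c c' i x := by
    intro i x; unfold InA; dsimp only; split_ifs
    · exact Iff.rfl
    · exact Or.comm
  refine ⟨fun i => ?_, fun i => ?_, fun j t t' u u' ht ht' hu hu' => hM.2.2.1 j t t' u u' ((sameB j t).1 ht) ((sameB j t').1 ht')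
    ((sameC j u).1 hu) ((sameC j u').1 hu'), fun i j l t t' u u' h ht ht' hu hu' => hM.2.2.2 i j l t t' u u' h
    ((sameB i t).1 ht) ((sameB j t').1 ht') ((sameC j u).1 hu) ((sameC l u').1 hu')⟩
  · dsimp only; split_ifs
    · exact hM.1 i
    · exact (hM.1 i).symm
  · dsimp only; split_ifs
    · exact hM.2.1 i
    · exact (hM.2.1 i).symm

/-- **NORMAL FORM** for the `(1,2,2)` model: translations (`b₀ ↦ 0`, `c₀ ↦ 0`), a covering automorphism (`b'₀ ↦` a listed
representative), orientation of the pairs, sorting of the indices by the code of `bᵢ`. -/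
theorem exists_normalForm2 (E : GEnc G) (hM : ModelD2 b b' c c') (hK : 0 < K) {dlist : List ℕ} {auts : List (G →+ G)}
    (hinj : ∀ f ∈ auts, Function.Injective f) (hcover : ∀ d : G, d ≠ 0 → ∃ f ∈ auts, E.enc (f d) ∈ dlist) :
    ∃ p p' q q' : Fin K → G, ModelD2 p p' q q' ∧ NF2 E p p' q q' ∧ p ⟨0, hK⟩ = 0 ∧ q ⟨0, hK⟩ = 0 ∧
      E.enc (p' ⟨0, hK⟩) ∈ dlist := by
  set i0 : Fin K := ⟨0, hK⟩
  -- orient first (so that the translation is by the smaller elements)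
  set bo : Fin K → G := fun i => if E.enc (b i) < E.enc (b' i) then b i else b' i
  set bo' : Fin K → G := fun i => if E.enc (b i) < E.enc (b' i) then b' i else b i
  set co : Fin K → G := fun i => if E.enc (c i) < E.enc (c' i) then c i else c' i
  set co' : Fin K → G := fun i => if E.enc (c i) < E.enc (c' i) then c' i else c i
  have hMo : ModelD2 bo bo' co co' := hM.orient E
  -- translate and apply the automorphism
  have hd : bo' i0 - bo i0 ≠ 0 := fun h => hMo.1 i0 (sub_eq_zero.1 h).symm
  obtain ⟨f, hf, hfd⟩ := hcover _ hd
  have hfi := hinj f hf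
  set b1 : Fin K → G := fun i => f (bo i - bo i0)
  set b1' : Fin K → G := fun i => f (bo' i - bo i0)
  set c1 : Fin K → G := fun i => f (co i - co i0)
  set c1' : Fin K → G := fun i => f (co' i - co i0)
  have hM1 : ModelD2 b1 b1' c1 c1' := hMo.map_sub f hfi (bo i0) (co i0)
  have hb1 : b1 i0 = 0 := by simp [b1]
  have hc1 : c1 i0 = 0 := by simp [c1]
  -- orient again (codes changed), then sort by the code of the smaller B-element
  set b2 : Fin K → G := fun i => if E.enc (b1 i) < E.enc (b1' i) then b1 i else b1' i
  set b2' : Fin K → G := fun i => if E.enc (b1 i) < E.enc (b1' i) then b1' i else b1 i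
  set c2 : Fin K → G := fun i => if E.enc (c1 i) < E.enc (c1' i) then c1 i else c1' i
  set c2' : Fin K → G := fun i => if E.enc (c1 i) < E.enc (c1' i) then c1' i else c1 i
  have hM2 : ModelD2 b2 b2' c2 c2' := hM1.orient E
  have hb2 : b2 i0 = 0 := by
    have h : E.enc (b1 i0) < E.enc (b1' i0) := by
      rw [hb1, E.enc_zero]; refine Nat.pos_of_ne_zero fun h0 => hM1.1 i0 ?_
      rw [hb1]; exact (E.enc_inj (h0.trans E.enc_zero.symm)).symm
    show (if E.enc (b1 i0) < E.enc (b1' i0) then b1 i0 else b1' i0) = 0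
    rw [if_pos h, hb1]
  have hb2' : b2' i0 = f (bo' i0 - bo i0) := by
    have h : E.enc (b1 i0) < E.enc (b1' i0) := by
      rw [hb1, E.enc_zero]; refine Nat.pos_of_ne_zero fun h0 => hM1.1 i0 ?_
      rw [hb1]; exact (E.enc_inj (h0.trans E.enc_zero.symm)).symm
    show (if E.enc (b1 i0) < E.enc (b1' i0) then b1' i0 else b1 i0) = _
    rw [if_pos h]
  have hc2 : c2 i0 = 0 := by
    have h : E.enc (c1 i0) < E.enc (c1' i0) := by
      rw [hc1, E.enc_zero]; refine Nat.pos_of_ne_zero fun h0 => hM1.2.1 i0 ?_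
      rw [hc1]; exact (E.enc_inj (h0.trans E.enc_zero.symm)).symm
    show (if E.enc (c1 i0) < E.enc (c1' i0) then c1 i0 else c1' i0) = 0
    rw [if_pos h, hc1]
  have hlt2 : ∀ i, E.enc (b2 i) < E.enc (b2' i) ∧ E.enc (c2 i) < E.enc (c2' i) := by
    intro i
    have hne1 : E.enc (b1 i) ≠ E.enc (b1' i) := fun e => hM1.1 i (E.enc_inj e)
    have hne2 : E.enc (c1 i) ≠ E.enc (c1' i) := fun e => hM1.2.1 i (E.enc_inj e)
    constructor
    · show E.enc (if E.enc (b1 i) < E.enc (b1' i) then b1 i else b1' i) <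
        E.enc (if E.enc (b1 i) < E.enc (b1' i) then b1' i else b1 i)
      split_ifs with h
      · exact h
      · omega
    · show E.enc (if E.enc (c1 i) < E.enc (c1' i) then c1 i else c1' i) <
        E.enc (if E.enc (c1 i) < E.enc (c1' i) then c1' i else c1 i)
      split_ifs with h
      · exact h
      · omega
  -- sort
  set σ := Tuple.sort (fun i => E.enc (b2 i))
  have hmono : Monotone ((fun i => E.enc (b2 i)) ∘ σ) := Tuple.monotone_sort _
  have hM3 : ModelD2 (b2 ∘ σ) (b2' ∘ σ) (c2 ∘ σ) (c2' ∘ σ) := hM2.reindex σ σ.injective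
  have hinjb : Function.Injective (fun i => E.enc ((b2 ∘ σ) i)) := by
    intro i j h
    have h' : b2 (σ i) = b2 (σ j) := E.enc_inj h
    have hin : InA b2 b2' (σ j) (b2 (σ i)) := by rw [h']; exact inA_p (σ j)
    exact σ.injective (hM2.b_disj (inA_p (σ i)) hin)
  have hsm : StrictMono (fun i => E.enc ((b2 ∘ σ) i)) := hmono.strictMono_of_injective hinjb
  have hσ0 : σ i0 = i0 := by
    have hi0le : i0 ≤ σ.symm i0 := by rw [Fin.le_def]; exact Nat.zero_le _
    have hle : E.enc (b2 (σ i0)) ≤ E.enc (b2 (σ (σ.symm i0))) := hmono hi0le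
    rw [Equiv.apply_symm_apply, hb2, E.enc_zero] at hle
    have h00 : E.enc ((b2 ∘ σ) i0) = E.enc ((b2 ∘ σ) (σ.symm i0)) := by
      show E.enc (b2 (σ i0)) = E.enc (b2 (σ (σ.symm i0))); rw [Equiv.apply_symm_apply, hb2, E.enc_zero]; omega
    have h3 := congrArg σ (hinjb h00)
    rw [Equiv.apply_symm_apply] at h3
    exact h3
  refine ⟨b2 ∘ σ, b2' ∘ σ, c2 ∘ σ, c2' ∘ σ, hM3, ⟨fun i j hij => hsm hij, fun i => (hlt2 (σ i)).1, fun i => (hlt2 (σ i)).2⟩,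
    ?_, ?_, ?_⟩
  · show b2 (σ i0) = 0; rw [hσ0, hb2]
  · show c2 (σ i0) = 0; rw [hσ0, hc2]
  · show E.enc (b2' (σ i0)) ∈ dlist; rw [hσ0, hb2']; exact hfd

/-- **REFLECTION (difference model).** A `true` kernel search over representatives covering every nonzero element (through
the injective maps of `auts`) excludes every solution of the `(1,2,2)` difference model (`K ≥ 1`). -/
theorem not_modelD2_of_search2 (E : GEnc G) (hK : 0 < K) {reps : List ℕ} (hsearch : search2 E.g K reps = true)
    {auts : List (G →+ G)} (hinj : ∀ f ∈ auts, Function.Injective f)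
    (hcover : ∀ d : G, d ≠ 0 → ∃ f ∈ auts, E.enc (f d) ∈ reps) (b b' c c' : Fin K → G) : ¬ ModelD2 b b' c c' := by
  intro hM
  obtain ⟨p, p', q, q', hM', hNF, hp0, hq0, hd⟩ := exists_normalForm2 E hM hK hinj hcover
  have := start2_of_search2 hsearch _ hd
  rw [start2_false hM' hNF hK hp0 hq0] at this
  exact Bool.false_ne_true this

/-- The finset form (right-hand side of `exists_isSTPP_122_iff`) implies the disjunctive model. -/
theorem modelD2_of_finsetForm [DecidableEq G] (hb : ∀ i, b i ≠ b' i) (hc : ∀ i, c i ≠ c' i)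
    (hU : ∀ j : Fin K, ∀ t ∈ ({b j, b' j} : Finset G), ∀ t' ∈ ({b j, b' j} : Finset G),
      ∀ u ∈ ({c j, c' j} : Finset G), ∀ u' ∈ ({c j, c' j} : Finset G), t' - u = t - u' → t = t' ∧ u = u')
    (hX : ∀ i j l : Fin K, (i ≠ j ∨ l ≠ j) → ∀ t ∈ ({b i, b' i} : Finset G), ∀ t' ∈ ({b j, b' j} : Finset G),
      ∀ u ∈ ({c j, c' j} : Finset G), ∀ u' ∈ ({c l, c' l} : Finset G), t' - u ≠ t - u') :
    ModelD2 b b' c c' := by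
  have memB : ∀ i x, InA b b' i x → x ∈ ({b i, b' i} : Finset G) := by rintro i x (rfl | rfl) <;> simp
  have memC : ∀ i x, InA c c' i x → x ∈ ({c i, c' i} : Finset G) := by rintro i x (rfl | rfl) <;> simp
  exact ⟨hb, hc, fun j t t' u u' ht ht' hu hu' h => hU j t (memB j t ht) t' (memB j t' ht') u (memC j u hu) u' (memC j u' hu') h,
    fun i j l t t' u u' hijl ht ht' hu hu' => hX i j l hijl t (memB i t ht) t' (memB j t' ht') u (memC j u hu) u' (memC l u' hu')⟩

/-- **REFLECTION THROUGH DEF. 5.1** (pattern `(1,2,2)^k`): under the hypotheses of `not_modelD2_of_search2`, `G` admits NO STPP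
family (CKSU Def. 5.1, tree `IsSTPP`) of `K` triples with `|Aᵢ| = 1`, `|Bᵢ| = |Cᵢ| = 2` — by the tree's criterion
`exists_isSTPP_122_iff`. [cite: CohnKleinbergSzegedyUmans2005, Def. 5.1] -/
theorem not_exists_isSTPP_122_of_search2 [DecidableEq G] (E : GEnc G) (hK : 0 < K) {reps : List ℕ}
    (hsearch : search2 E.g K reps = true) {auts : List (G →+ G)} (hinj : ∀ f ∈ auts, Function.Injective f)
    (hcover : ∀ d : G, d ≠ 0 → ∃ f ∈ auts, E.enc (f d) ∈ reps) :
    ¬ ∃ A B C : Fin K → Finset G, IsSTPP A B C ∧ ∀ i, (A i).card = 1 ∧ (B i).card = 2 ∧ (C i).card = 2 := by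
  rw [exists_isSTPP_122_iff]
  rintro ⟨p, p', q, q', hb, hc, hU, hX⟩
  exact not_modelD2_of_search2 E hK hsearch hinj hcover p p' q q' (modelD2_of_finsetForm hb hc hU hX)

end Refl

end STPP122Neg

end Summit.MatrixMultiplication.OmegaCensus
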